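import Mathlib.Analysis.SpecificLimits.Basic
import Summits.Ventures.CertifiedArithmetic.LowPrec.GemmThetaLawMixCFamily
import Summits.Ventures.CertifiedArithmetic.LowPrec.GemmThetaLawGenMixCCert
import Summits.Ventures.CertifiedArithmetic.LowPrec.GemmWorstCaseE2M1
import HarnessLib

/-!
# GEMM worst case LVIII — `W_p(n)` for E3M2·E2M3 (FP6·FP6) into EVERY precision `p ≥ 15`: the
# two-sided sandwich `θ_p/(n - 1 + θ_p(193/2 + κ_p)) ≤ 1 - W_p(n) ≤ θ_p/(n - c_p)` and the
# limit `n(1 - W_p(n)) → θ_p`, kernel-checked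

HONEST FRAMING: certified error envelopes and provably optimal rounding/accumulation schemes for
low-precision formats under stated cost models; every table by two implementations; no hardware or
vendor claims.

`W_φ(n)` (`worstRelErrMixC φ (n-1)`) is the largest relative error `|ŝ - s|/Σ|x_i|` of
sequential round-to-nearest-even accumulation in the format `φ` over ALL words of `n` letters
from the 481-letter mixed product alphabet `Λ(E3M2·E2M3)/2^7` of the generated law
`e3m2e2m3Law` (`GemmThetaLawGenMixCData`; every product of an E3M2 and an E2M3 datum is such a
letter, `mul_mem_PiL_e3m2e2m3` of `GemmThetaLawGenMixCCert`) — a finite maximum.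
For every format `φ` with `14 ≤ manBits φ` (`p ≥ 15`), `qexp φ ≤ -7` and
`2^(manBits φ + 17) ≤ maxRat φ` (binary32, binary64, …), with the law's constants
`θ_p = e3m2e2m3Law.thetaL (manBits φ) = (33·2^manBits + 64)/2016`,
`κ_p = 8192/(136·2^manBits + 256)` (`e3m2e2m3Law_constants`) and `K = 2^(p-13)`
(`2^manBits = 4096K`, `θ_p = (4224K + 2)/63`):

* `worst7P_le` (SUP side, every `n`): `W_φ(n) ≤ 1 - θ_p/(n - 1 + θ_p(1 + 191/2 + κ_p))` —
  the generated law certificate `thetaCert_e3m2e2m3Law` (`GemmThetaLawGenMixCCert`) through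
  `ThetaCertificate.abs_err_le` (`ρ = 63/2 ≤ β_pair = 191/2`);
* `one_sub_worst7P_le` (the family of files LVII, every `n ≥ 55297K + 1`, every `p ≥ 13`):
  `1 - W_φ(n) ≤ (4224K + 2)/(63n - 3219455K + 2) = θ_p/(n - c_p)`, `c_p = (3219455K - 2)/63`;
* `worst7P_sandwich`: both at once — the E3M2·E2M3 row of gemm.tex Thm. `t:thetapmix` for
  every `p ≥ 15`, with onset `m_p = 55297K + 1 = 27·2^(p-2) + 1 + 2^(p-13)`;
* `worst7P_tendsto`: `n·(1 - W_φ(n)) → θ_p` (in `ℝ`, by the sandwich);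
* `worst7P_sandwich_Binary32`: the instance `p = 24` (`K = 2048`) in integers —
  `5507377716078/(40108041n + 531461949039790) ≤ 1 - W_24(n) ≤ 8650754/(63n - 6593443838)`
  for every `n ≥ 113248257` (the left side agrees with `abs_dot_err_le_e3m2e2m3_Binary32`;
  `8650754 = 63θ_24`, `θ_24 = 1235822/9`; here `κ_p θ_p < 1`, so the two numerators differ).

What is NOT claimed: the exact value of `W_p(n)` between the two sides; `p ∈ {13, 14}` (the
family of files LVII is valid there, but the law certificate needs `p ≥ 15`); `p ≤ 12` (other
maximisers; Table S4T-lawmix rows by exhaustive search only).  References: [Higham2002, §4.2],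
[MullerEtAl2018HFPA, §6.1], [BoldoMelquiond2011Flocq]; [RouhaniEtAl2023MX, Table 1].
-/

namespace Summit.Ventures.CertifiedArithmetic.LowPrec.Gemm

open Literature.ComputerArithmetic.FloatingPoint
open Literature.ComputerArithmetic.FloatingPoint.MiniFloat
open Literature.ComputerArithmetic.FloatingPoint.MiniFloat.ThetaLaw
open Finset

/-! ### `W_φ(n)` over the mixed alphabet, any target format -/

/-- The law's alphabet `Λ(E3M2·E2M3)` has `481 = 1 + 2·240` grid integers. [cell, kernel] -/
theorem lamMixC_length : e3m2e2m3Law.lam.length = 481 := by decide +kernel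

/-- THE INPUT SPELLED BY A WORD `w : Fin (m+1) → Fin 481` (letters `Λ/2^7` by index; `0` after
position `m`). [cell, gemm.tex §Model] -/
def wordInputMixC {m : ℕ} (w : Fin (m + 1) → Fin 481) : ℕ → ℚ :=
  fun j => if h : j < m + 1 then
      ((e3m2e2m3Law.lam[(w ⟨j, h⟩).val]'(by rw [lamMixC_length]; exact (w _).isLt) : ℤ) : ℚ)
        / 2 ^ 7
    else 0

/-- Every term of a word input is a letter of the law. [cell] -/
theorem wordInputMixC_mem {m : ℕ} (w : Fin (m + 1) → Fin 481) (j : ℕ) :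
    e3m2e2m3Law.PiL 7 (wordInputMixC w j) := by
  unfold wordInputMixC
  split_ifs
  · exact ⟨_, List.getElem_mem _, rfl⟩
  · exact ⟨0, by decide, by norm_num⟩

/-- `W_φ(n)` for `n = m + 1`: the largest relative error of sequential RNE accumulation in `φ`
over all words of `n` letters from `Λ(E3M2·E2M3)/2^7`. [cell, gemm.tex §Regimes] -/
def worstRelErrMixC (φ : Format) (m : ℕ) : ℚ :=
  (univ : Finset (Fin (m + 1) → Fin 481)).sup' univ_nonempty
    (fun w => relErr φ (wordInputMixC w) m)

/-- Every input over the alphabet is dominated by `W_φ`. [folklore] -/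
theorem relErr_le_worst7P (φ : Format) (x : ℕ → ℚ) (hx : ∀ j, e3m2e2m3Law.PiL 7 (x j))
    (m : ℕ) : relErr φ x m ≤ worstRelErrMixC φ m := by
  classical
  have hidx : ∀ j, ∃ i : Fin 481, ∀ h : i.val < e3m2e2m3Law.lam.length,
      ((e3m2e2m3Law.lam[i.val]'h : ℤ) : ℚ) / 2 ^ 7 = x j := by
    intro j
    obtain ⟨z, hz, hxz⟩ := hx j
    obtain ⟨i, hi, h⟩ := List.getElem_of_mem hz
    exact ⟨⟨i, by simpa [lamMixC_length] using hi⟩, fun _ => by rw [hxz, ← h]⟩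
  choose f hf using hidx
  have hxy : ∀ j ≤ m, x j = wordInputMixC (fun j : Fin (m + 1) => f j.val) j := by
    intro j hj
    unfold wordInputMixC
    rw [dif_pos (by omega)]
    exact (hf j _).symm
  rw [relErr_congr φ hxy]
  exact le_sup' (fun w => relErr φ (wordInputMixC w) m) (mem_univ _)

/-! ### The law's constants for every precision -/

/-- THE CONSTANTS OF THE E3M2·E2M3 LAW AT EVERY `m = manBits`: `θ = (33·2^m + 64)/2016`,
`κ = 8192/(136·2^m + 256)`, `ρ = 63/2`, `β_pair = 191/2`. [cell, gemm.tex Thm. t:thetapmix] -/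
theorem e3m2e2m3Law_constants (mb : ℕ) :
    e3m2e2m3Law.thetaL mb = (33 * 2 ^ mb + 64) / 2016 ∧
    e3m2e2m3Law.kappaL mb = 8192 / (136 * 2 ^ mb + 256) ∧
    e3m2e2m3Law.rhoL = 63 / 2 ∧ e3m2e2m3Law.betaL = 191 / 2 := by
  have hB : e3m2e2m3Law.Bj 13 = 136 := by decide
  have hS : e3m2e2m3Law.Sj 13 = 256 := by decide
  simp only [LawData.thetaL, LawData.kappaL, LawData.rhoL, LawData.betaL,
    show e3m2e2m3Law.kb = 13 from rfl, hB, hS, show e3m2e2m3Law.th1 = 33 from rfl,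
    show e3m2e2m3Law.th0 = 64 from rfl, show e3m2e2m3Law.thD = 2016 from rfl,
    show e3m2e2m3Law.rhoN = 63 from rfl, show e3m2e2m3Law.rhoD = 2 from rfl,
    show e3m2e2m3Law.betaN = 191 from rfl, show e3m2e2m3Law.betaD = 2 from rfl]
  norm_num

/-- With `K = 2^(p-13)` (`2^manBits = 4096K`): `θ_p = (4224K + 2)/63`.
[gemm.tex Thm. t:thetapmix] -/
theorem thetaL7_eq {φ : Format} {K : ℕ} (hM : 2 ^ φ.manBits = 4096 * K) :
    e3m2e2m3Law.thetaL φ.manBits = (4224 * (K : ℚ) + 2) / 63 := by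
  have hM' : ((2 ^ φ.manBits : ℕ) : ℚ) = ((4096 * K : ℕ) : ℚ) := by rw [hM]
  push_cast at hM'
  rw [(e3m2e2m3Law_constants φ.manBits).1, hM', div_eq_div_iff (by norm_num) (by norm_num)]
  ring

/-- `θ_p > 0`. [cell] -/
theorem thetaL7_pos (mb : ℕ) : 0 < e3m2e2m3Law.thetaL mb := by
  rw [(e3m2e2m3Law_constants mb).1]; positivity

/-- `κ_p ≥ 0`. [cell] -/
theorem kappaL7_nonneg (mb : ℕ) : 0 ≤ e3m2e2m3Law.kappaL mb := by
  rw [(e3m2e2m3Law_constants mb).2.1]; positivity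

/-! ### The sandwich -/

/-- SUP SIDE FOR EVERY `p ≥ 15` AND EVERY `n = m + 1` (kernel: the generated law certificate
`thetaCert_e3m2e2m3Law`): `W_φ(n) ≤ 1 - θ_p/(m + θ_p(1 + 191/2 + κ_p))`.
[cell, gemm.tex Thm. t:thetapmix] -/
theorem worst7P_le (φ : Format) (hm : 14 ≤ φ.manBits) (hq : φ.qexp ≤ -7)
    (hR : (2 : ℚ) ^ (φ.manBits + 17) ≤ φ.maxRat) (m : ℕ) :
    worstRelErrMixC φ m ≤ 1 - e3m2e2m3Law.thetaL φ.manBits /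
      ((m : ℚ) + e3m2e2m3Law.thetaL φ.manBits
        * (1 + (191 / 2 + e3m2e2m3Law.kappaL φ.manBits))) := by
  have hθ := thetaL7_pos φ.manBits
  have hκ := kappaL7_nonneg φ.manBits
  apply sup'_le
  intro w _
  unfold relErr
  have hc : (0 : ℚ) ≤ 1 - e3m2e2m3Law.thetaL φ.manBits /
      ((m : ℚ) + e3m2e2m3Law.thetaL φ.manBits
        * (1 + (191 / 2 + e3m2e2m3Law.kappaL φ.manBits))) := by
    rw [sub_nonneg, div_le_one (by positivity)]
    nlinarith [show (0 : ℚ) ≤ m from Nat.cast_nonneg m]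
  by_cases hL : ∑ j ∈ range (m + 1), |wordInputMixC w j| = 0
  · rw [hL, div_zero]; exact hc
  · have hpos : 0 < ∑ j ∈ range (m + 1), |wordInputMixC w j| :=
      lt_of_le_of_ne (sum_nonneg fun i _ => abs_nonneg _) (Ne.symm hL)
    rw [div_le_iff₀ hpos]
    have h := (thetaCert_e3m2e2m3Law φ hm hq hR).abs_err_le (fun q hq' => PiL_neg _ _ hq') _
      (fun j => wordInputMixC_mem w j) m
    rw [(e3m2e2m3Law_constants φ.manBits).2.2.1, (e3m2e2m3Law_constants φ.manBits).2.2.2,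
      max_eq_right (by norm_num : (63 / 2 : ℚ) ≤ 191 / 2)] at h
    exact h

/-- THE FAMILY SIDE FOR EVERY `n = m + 1 ≥ 55297K + 1` (files LVII, `K = 2^(p-13)`, every
`p ≥ 13`): `1 - W_φ(n) ≤ (4224K + 2)/(63n - 3219455K + 2) = θ_p/(n - c_p)`.
[cell, gemm.tex Thm. t:thetapmix] -/
theorem one_sub_worst7P_le (φ : Format) (hq : φ.qexp ≤ -7)
    (hR : (2 : ℚ) ^ (φ.manBits + 17) ≤ φ.maxRat) {K : ℕ} (hM : 2 ^ φ.manBits = 4096 * K)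
    (m : ℕ) (hmK : 55297 * K ≤ m) :
    1 - worstRelErrMixC φ m
      ≤ (4224 * (K : ℚ) + 2) / (63 * ((m : ℚ) + 1) - 3219455 * K + 2) := by
  have hw := relErr_le_worst7P φ (fam7 K) (fam7_mem K) m
  have hd := fam7_defect hq hR hM m hmK
  unfold relErr at hw
  linarith

/-- THE TWO-SIDED SANDWICH FOR EVERY PRECISION `p ≥ 15` AND EVERY `n ≥ 55297·2^(p-13) + 1`
(`n = m + 1`, `K = 2^(p-13)`, `θ_p = (4224K + 2)/63`, `κ_p = 8192/(136·2^manBits + 256)`):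
`θ_p/(m + θ_p(1 + 191/2 + κ_p)) ≤ 1 - W_p(n) ≤ θ_p/(n - (3219455K - 2)/63)`, both sides
kernel-checked. [cell, gemm.tex Thm. t:thetapmix] -/
theorem worst7P_sandwich (φ : Format) (hm : 14 ≤ φ.manBits) (hq : φ.qexp ≤ -7)
    (hR : (2 : ℚ) ^ (φ.manBits + 17) ≤ φ.maxRat) {K : ℕ} (hM : 2 ^ φ.manBits = 4096 * K)
    (m : ℕ) (hmK : 55297 * K ≤ m) :
    e3m2e2m3Law.thetaL φ.manBits /
        ((m : ℚ) + e3m2e2m3Law.thetaL φ.manBits * (1 + (191 / 2 + e3m2e2m3Law.kappaL φ.manBits)))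
        ≤ 1 - worstRelErrMixC φ m ∧
      1 - worstRelErrMixC φ m
        ≤ e3m2e2m3Law.thetaL φ.manBits / ((m + 1 : ℚ) - (3219455 * K - 2) / 63) := by
  refine ⟨by linarith [worst7P_le φ hm hq hR m], ?_⟩
  have h := one_sub_worst7P_le φ hq hR hM m hmK
  have eB : (m + 1 : ℚ) - (3219455 * K - 2) / 63
      = (63 * ((m : ℚ) + 1) - 3219455 * K + 2) / 63 := by
    ring
  rw [thetaL7_eq hM, eB, div_div_div_cancel_right₀ (by norm_num : (63 : ℚ) ≠ 0)]
  exact h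

/-- THE LIMIT, EVERY PRECISION `p ≥ 15`: `n · (1 - W_p(n)) → θ_p` as `n → ∞` (squeezed
between the two sides of `worst7P_sandwich`). [cell, gemm.tex Thm. t:thetapmix] -/
theorem worst7P_tendsto (φ : Format) (hm : 14 ≤ φ.manBits) (hq : φ.qexp ≤ -7)
    (hR : (2 : ℚ) ^ (φ.manBits + 17) ≤ φ.maxRat) :
    Filter.Tendsto (fun m : ℕ => ((m : ℝ) + 1) * (1 - (worstRelErrMixC φ m : ℝ)))
      Filter.atTop (nhds (e3m2e2m3Law.thetaL φ.manBits : ℝ)) := by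
  obtain ⟨K, hM⟩ : ∃ K, 2 ^ φ.manBits = 4096 * K :=
    ⟨2 ^ (φ.manBits - 12), by
      rw [show (4096 : ℕ) = 2 ^ 12 by norm_num, ← pow_add, Nat.add_sub_cancel' (by omega)]⟩
  set θ : ℝ := (e3m2e2m3Law.thetaL φ.manBits : ℝ) with hθdef
  set a : ℝ := θ * (1 + (191 / 2 + (e3m2e2m3Law.kappaL φ.manBits : ℝ))) - 1 with hadef
  set b : ℝ := (3219455 * (K : ℝ) - 2) / 63 with hbdef
  have hlim0 : Filter.Tendsto (fun m : ℕ => 1 / ((m : ℝ) + 1)) Filter.atTop (nhds 0) :=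
    tendsto_one_div_add_atTop_nhds_zero_nat
  have hg : Filter.Tendsto (fun m : ℕ => θ / (1 + a * (1 / ((m : ℝ) + 1)))) Filter.atTop
      (nhds θ) := by
    have h : Filter.Tendsto (fun m : ℕ => θ / (1 + a * (1 / ((m : ℝ) + 1)))) Filter.atTop
        (nhds (θ / (1 + a * 0))) :=
      tendsto_const_nhds.div (tendsto_const_nhds.add (tendsto_const_nhds.mul hlim0))
        (by norm_num)
    rw [mul_zero, add_zero, div_one] at h
    exact h
  have hh : Filter.Tendsto (fun m : ℕ => θ / (1 - b * (1 / ((m : ℝ) + 1)))) Filter.atTop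
      (nhds θ) := by
    have h : Filter.Tendsto (fun m : ℕ => θ / (1 - b * (1 / ((m : ℝ) + 1)))) Filter.atTop
        (nhds (θ / (1 - b * 0))) :=
      tendsto_const_nhds.div (tendsto_const_nhds.sub (tendsto_const_nhds.mul hlim0))
        (by norm_num)
    rw [mul_zero, sub_zero, div_one] at h
    exact h
  refine tendsto_of_tendsto_of_tendsto_of_le_of_le' hg hh ?_ ?_
  · refine Filter.eventually_atTop.2 ⟨55297 * K, fun m hmK => ?_⟩
    have hr1 := (Rat.cast_le (K := ℝ)).mpr (worst7P_sandwich φ hm hq hR hM m hmK).1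
    push_cast at hr1
    have hm0 : (0 : ℝ) < (m : ℝ) + 1 := by positivity
    have hm1 : (m : ℝ) + 1 ≠ 0 := hm0.ne'
    have e1 : 1 + a * (1 / ((m : ℝ) + 1)) = (((m : ℝ) + 1) + a) / ((m : ℝ) + 1) := by
      rw [eq_div_iff hm1, add_mul, one_mul, mul_assoc, one_div_mul_cancel hm1, mul_one]
    have e2 : ((m : ℝ) + 1) + a
        = (m : ℝ) + θ * (1 + (191 / 2 + (e3m2e2m3Law.kappaL φ.manBits : ℝ))) := by
      rw [hadef]; ring
    show θ / (1 + a * (1 / ((m : ℝ) + 1))) ≤ ((m : ℝ) + 1) * (1 - (worstRelErrMixC φ m : ℝ))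
    rw [e1, div_div_eq_mul_div, e2]
    calc θ * ((m : ℝ) + 1) / ((m : ℝ) + θ * (1 + (191 / 2 + (e3m2e2m3Law.kappaL φ.manBits : ℝ))))
        = ((m : ℝ) + 1) *
            (θ / ((m : ℝ) + θ * (1 + (191 / 2 + (e3m2e2m3Law.kappaL φ.manBits : ℝ))))) := by ring
      _ ≤ ((m : ℝ) + 1) * (1 - (worstRelErrMixC φ m : ℝ)) :=
          mul_le_mul_of_nonneg_left hr1 hm0.le
  · refine Filter.eventually_atTop.2 ⟨55297 * K, fun m hmK => ?_⟩
    have hr2 := (Rat.cast_le (K := ℝ)).mpr (worst7P_sandwich φ hm hq hR hM m hmK).2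
    push_cast at hr2
    have hm0 : (0 : ℝ) < (m : ℝ) + 1 := by positivity
    have hm1 : (m : ℝ) + 1 ≠ 0 := hm0.ne'
    have e1 : 1 - b * (1 / ((m : ℝ) + 1)) = (((m : ℝ) + 1) - b) / ((m : ℝ) + 1) := by
      rw [eq_div_iff hm1, sub_mul, one_mul, mul_assoc, one_div_mul_cancel hm1, mul_one]
    show ((m : ℝ) + 1) * (1 - (worstRelErrMixC φ m : ℝ))
      ≤ θ / (1 - b * (1 / ((m : ℝ) + 1)))
    rw [e1, div_div_eq_mul_div, hbdef]
    calc ((m : ℝ) + 1) * (1 - (worstRelErrMixC φ m : ℝ))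
        ≤ ((m : ℝ) + 1) * (θ / (((m : ℝ) + 1) - (3219455 * (K : ℝ) - 2) / 63)) :=
          mul_le_mul_of_nonneg_left hr2 hm0.le
      _ = θ * ((m : ℝ) + 1) / (((m : ℝ) + 1) - (3219455 * (K : ℝ) - 2) / 63) := by ring

/-! ### The instance `p = 24` (binary32) in integers -/

/-- binary32 meets the hypotheses, with `K = 2^11 = 2048`. [cite: IEEE7542019, Table 3.5] -/
theorem Binary32_hyps7 : 14 ≤ Format.Binary32.manBits ∧ Format.Binary32.qexp ≤ -7 ∧
    (2 : ℚ) ^ (Format.Binary32.manBits + 17) ≤ Format.Binary32.maxRat ∧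
    2 ^ Format.Binary32.manBits = 4096 * 2048 := by
  obtain ⟨h1, h2, h3⟩ := Binary32_hyps_e3m2e2m3
  exact ⟨by rw [h1]; norm_num, h2, h3, by rw [h1]; norm_num⟩

/-- E3M2·E2M3 INTO binary32, EVERY `n ≥ 113248257 = 55297·2^11 + 1`:
`5507377716078/(40108041n + 531461949039790) ≤ 1 - W_24(n) ≤ 8650754/(63n - 6593443838)`
(`8650754 = 63θ_24`, `θ_24 = 1235822/9`); the left side holds for every `n` (the law's envelope
`abs_dot_err_le_e3m2e2m3_Binary32`), the right side is the family; `n(1 - W_24(n)) → θ_24`.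
[cell, gemm.tex Thm. t:thetapmix at p = 24] -/
theorem worst7P_sandwich_Binary32 (m : ℕ) (hm : 113248256 ≤ m) :
    5507377716078 / (40108041 * ((m : ℚ) + 1) + 531461949039790)
        ≤ 1 - worstRelErrMixC Format.Binary32 m ∧
      1 - worstRelErrMixC Format.Binary32 m ≤ 8650754 / (63 * ((m : ℚ) + 1) - 6593443838) := by
  obtain ⟨h1, h2, h3, h4⟩ := Binary32_hyps7
  have h := worst7P_sandwich Format.Binary32 h1 h2 h3 h4 m (by omega)
  rw [Binary32_hyps_e3m2e2m3.1, lawConstants_e3m2e2m3_Binary32.1,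
    lawConstants_e3m2e2m3_Binary32.2.1] at h
  have hm' : (113248256 : ℚ) ≤ m := by exact_mod_cast hm
  have e1 : (1235822 / 9 : ℚ) / ((m : ℚ) + 1235822 / 9 * (1 + (191 / 2 + 32 / 4456449)))
      = 5507377716078 / (40108041 * ((m : ℚ) + 1) + 531461949039790) := by
    rw [div_eq_div_iff (by positivity) (by positivity)]; ring
  have e2 : (1235822 / 9 : ℚ) / ((m + 1 : ℚ) - (3219455 * ((2048 : ℕ) : ℚ) - 2) / 63)
      = 8650754 / (63 * ((m : ℚ) + 1) - 6593443838) := by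
    rw [div_eq_div_iff (ne_of_gt (by push_cast; linarith)) (ne_of_gt (by linarith))]
    push_cast; ring
  rw [e1, e2] at h
  exact h

end Summit.Ventures.CertifiedArithmetic.LowPrec.Gemm
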